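import Literature.RepresentationTheory.MoeglinVignerasWaldspurger1987.RankOneThetaAnisotropicPlaneDichotomyCentre
import Literature.NumberTheory.GelbartRogawski1991.LocalDoubledDiagonalScalar
import Literature.NumberTheory.GelbartRogawski1991.LocalSplittingCMBlockRestriction
import HarnessLib

/-!
# The centre character `χ_v ∘ det` of the CM theta package through a line: it OCCURS iff the type set of the CM section of the
# NEGATED line meets that of the second block — the doubling relation (D) read through the two-block type criterion; the pin as disjointness

Topic `NumberTheory/GelbartRogawski1991`; namespace `Literature.NumberTheory.GelbartRogawski1991.UnitaryDualPair.LocalSplitting`.  KERNEL ONLY: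
theorems; no definition, no named fact, no `sorry`, no instance, no notation.  Cell `hodgecm-mathlib` (D-0151), fan B, L1ns road (P) of the crux
hLiu418 — brick E1, the junction of the «doubling relation (D)» (★ `LocalDoubledDiagonalScalar`, ★ `LocalSplittingCMSwapTransport`) with the rank-one
theta machinery of ★ `RankOneThetaLiftLineTypeCriterion` ∕ ★ `RankOneThetaAnisotropicPlaneDichotomyCentre` (memo
`F0/P6/B-p04/g44/MEMO-L1ns-road.v3.B-p04g44.md` §2 (c) «(P) ⟺ (P′)», made formal); `--supports stmt-HodgeConjecture-24832`, count-neutral.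

SETTING.  `L` CM, `v` a finite place of `L⁺` that does not split in `L` (`hE : IsField (L ⊗ L⁺_v)`), a line `T₁ ∈ L⁺ˣ` and `T₂ ∈ Sym_{n₂}(L⁺)`
invertible, `J = (T₁ ⊕ᶠ T₂) ⊗ 1`, `s_V := localSplittingCMWith … (T₁ ⊕ᶠ T₂) … v μ` (Kudla's CM section for the splitting Hecke character `χ`),
the centre `E_v¹ = U(J′)(L⁺_v)` of `U(J)(L⁺_v)` read through any hermitian line `J′` (★ `localCenter`), and a character `e′` of `U(J′)(L⁺_v)` with open
kernel agreeing with `z ↦ ∏_{w ∣ v} χ_w(z_w)` — the letter's `μ_v|_{E_v¹}`.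

* **`nontrivial_theta_localSplittingCMWith_iff_exists_type_neg`** — `Θ_{s_V}(e′) ≠ 0` (the `e′`-coinvariants of `ω ∘ s_V ∘ (z ↦ z·1)`) **iff**
  some open-kernel character `ζ` of the centre is a type of BOTH `ω_{−T₁} ∘ s_{−T₁} ∘ toNegForm ∘ (z ↦ z)` (CM section of the NEGATED line) and
  `ω_{T₂} ∘ restrictRight(s_V) ∘ (z ↦ z·1)` (second block).  Proof: the two-block criterion (★ `nontrivial_theta_iff_exists_lineType` ∕ ★
  `nontrivial_theta_of_lineTypes`: `Θ(e′) ≠ 0 ⟺ ∃ ξ ∈ S(s₁)` with `e′·(ξ∘c₁)⁻¹ ∈ S(block 2)`), the line see-saw ★ `restrictLeft_localSplittingCMWith`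
  (`s₁ = s_{T₁}`), and the doubling relation (D) along the centre map `c₁ : U(J′) → U(T₁)` (★
  `nontrivial_coinv_localSplittingCMWith_neg_of_nontrivial_coinv_of_det` ∕ mirror with `φ = c₁`: `ξ∘c₁ ∈ S(s_{T₁} ∘ c₁) ⟺ e′·(ξ∘c₁)⁻¹ ∈
  S(s_{−T₁} ∘ toNegForm ∘ c₁)`; types moved between `U(J₁)` and `U(J′)` along the centre isomorphism, ★ `localCenter_one_one_inverse`, ★
  `TwistedCoinv.ker_comp_mulEquiv`; compactness ★ `compactSpace_localPi_rankOne`).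
* **`vanishingCentre_eq_iff_forall_not_type_neg`** — with `e′` unitary continuous and `χ₀` any character satisfying the dichotomy «`Θ_{s_V}(χ′) ≠ 0 ⟺
  χ′ ≠ χ₀`» (★ `rankOne_theta_anisotropicPlane_dichotomy_centre` for the anisotropic plane): **`χ₀ = e′ ⟺` the two type sets above are DISJOINT** (on
  open-kernel characters).  This is the L1ns pin (P) «the vanishing centre character is `μ_v|_{E_v¹}`» rewritten as a rank-one DISJOINTNESS statement
  — half of the rank-one dichotomy ∕ complementarity [HarrisKudlaSweet1996, Thm. 6.1 (n = 1)] for the lines `−T₁` and `T₂` (in different classes iff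
  the plane is anisotropic), the organ of the LD2 line (★ `LemD1Item4AtV2SeparationOfBlockZeroTrace` §3).

What is NOT done here: the identification of the second block `restrictRight(s_V)` with `s_{T₂}` (right-block see-saw; the left one is ★), the junction
`(𝓢_{λ,a}).s v ↔ localSplittingCMWith` of the letter's package, and the disjointness itself.  HC_CM is NOT proved here and is proved only modulo the
printed citations (2 remaining named inputs hLiu418, h413) until rung 0 closes.

## References
* [Kudla1994] S. Kudla, Israel J. Math. 87 (1994), §3 Thm. 3.1.
* [HarrisKudlaSweet1996] M. Harris, S. Kudla, W. Sweet, J. AMS 9 (1996), §3, §6 Thm. 6.1.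
* [MoeglinVignerasWaldspurger1987] C. Mœglin, M.-F. Vignéras, J.-L. Waldspurger, LNM 1291 (1987), Chap. 2 II.1 Rem. (6); Chap. 3 IV.4.
* [Liu2021] Y. Liu, Camb. J. Math. 9 (2021), App. D Lemma D.1 (1).
-/

set_option autoImplicit false

noncomputable section

open scoped Matrix
open NumberField IsDedekindDomain MeasureTheory Matrix
open Literature.RepresentationTheory Literature.RepresentationTheory.HeisenbergGroup
open Literature.RepresentationTheory.TwistedCoinv
open Literature.RepresentationTheory.MoeglinVignerasWaldspurger1987
open Literature.NumberTheory.Automorphic Literature.NumberTheory.Automorphic.UnitaryGroup Literature.NumberTheory.Weil1964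
open Literature.NumberTheory.GaloisRepresentations Literature.RepresentationTheory.HarrisKudlaSweet1996

namespace Literature.NumberTheory.GelbartRogawski1991.UnitaryDualPair.LocalSplitting

variable (L : Type) [Field L] [NumberField L] [IsCMField L] (v : HeightOneSpectrum (𝓞 (maximalRealSubfield L)))
  [MeasurableSpace (v.adicCompletion (maximalRealSubfield L))] [BorelSpace (v.adicCompletion (maximalRealSubfield L))]
  (μ : Measure (v.adicCompletion (maximalRealSubfield L))) [μ.IsAddHaarMeasure]
  (n₂ : ℕ) {T₁ : Matrix (Fin 1) (Fin 1) (maximalRealSubfield L)} {T₂ : Matrix (Fin n₂) (Fin n₂) (maximalRealSubfield L)}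

/-- a `1 × 1` matrix is diagonal. [folklore] -/
private theorem eq_diagonal_fin_one {R : Type*} [Zero R] (M : Matrix (Fin 1) (Fin 1) R) : M = Matrix.diagonal fun _ => M 0 0 := by
  ext i j
  obtain rfl : i = 0 := Subsingleton.elim _ _
  obtain rfl : j = 0 := Subsingleton.elim _ _
  rw [Matrix.diagonal_apply_eq]

set_option synthInstance.maxHeartbeats 400000 in
set_option maxHeartbeats 4000000 in -- block-currency terms + the doubled CM datum's telescope
/-- **THE CENTRE CHARACTER `χ_v ∘ det` OF THE CM THETA PACKAGE THROUGH A LINE OCCURS IFF THE TYPES OF `s_{−T₁}` MEET THOSE OF THE SECOND BLOCK.**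
Setting: `L` CM, `v` a finite place of `L⁺` INERT OR RAMIFIED in `L` (`hE`), `T₁ ∈ L⁺ˣ` a line and `T₂ ∈ Sym_{n₂}(L⁺)` invertible, `J = (T₁ ⊕ᶠ T₂) ⊗ 1`,
`s_V = localSplittingCMWith … (T₁ ⊕ᶠ T₂) … v μ` Kudla's CM section of `U(J)(L⁺_v)` for the splitting Hecke character `χ`, the centre `E_v¹` read
through any hermitian line `J′` (`z ↦ z·1`, ★ `localCenter`), and `e′` ANY character of `U(J′)(L⁺_v)` with open kernel agreeing with
`z ↦ ∏_{w ∣ v} χ_w(z_w)` (`he'`).  Then the `e′`-coinvariants of `ω ∘ s_V ∘ (z ↦ z·1)` — the theta lift `Θ_{s_V}(e′)` — are NON-ZERO iff there is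
a character `ζ` of `U(J′)(L⁺_v)` with open kernel which is a type of BOTH `ω_{−T₁} ∘ s_{−T₁} ∘ toNegForm ∘ (z ↦ z)` (the CM section of the
NEGATED line `−T₁`) and `ω_{T₂} ∘ restrictRight(s_V) ∘ (z ↦ z·1)` (the second block).
Proof: ★ `nontrivial_theta_iff_exists_lineType` ∕ ★ `nontrivial_theta_of_lineTypes` (the two-block type criterion: `Θ(e′) ≠ 0 ⟺ ∃ ξ ∈ S(s₁)`
with `e′·(ξ∘c₁)⁻¹` a type of block 2), ★ `restrictLeft_localSplittingCMWith` (`s₁ = s_{T₁}`), and the doubling relation (D) for the line `T₁`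
(★ `nontrivial_coinv_localSplittingCMWith_neg_of_nontrivial_coinv_of_det` ∕ mirror: `ξ ∈ S(s_{T₁}) ⟺ (χ_v∘det)·ξ⁻¹ ∈ S(s_{−T₁} ∘ toNegForm)`),
transported along the centre isomorphism `U(J′) ≅ U(J₁)` (★ `localCenter_one_one_inverse`, ★ `TwistedCoinv.ker_comp_mulEquiv`).
For the L1ns letter (`n₂ = 1`, anisotropic plane, ★ `rankOne_theta_anisotropicPlane_dichotomy_centre`): the pin «the vanishing centre character is
`χ_v|_{E_v¹}`» ⟺ the type sets of the CM sections of the lines `−T₁` and (the second block of) `T₂` are DISJOINT.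
[cite: Kudla1994, §3 Thm. 3.1] [cite: HarrisKudlaSweet1996, §3, §6] [cite: MoeglinVignerasWaldspurger1987, Chap. 2 II.1 Rem. (6); Chap. 3 IV.4] -/
theorem nontrivial_theta_localSplittingCMWith_iff_exists_type_neg (hE : IsField (UnitaryGroup.LocalRing L v))
    (hT₁ : T₁.IsSymm) (hT₂ : T₂.IsSymm) (hT₁d : IsUnit T₁.det) (hT₂d : IsUnit T₂.det)
    {J₁ : Matrix (Fin 1) (Fin 1) L} (hJ₁ : J₁ = T₁.map (algebraMap (maximalRealSubfield L) L))
    {J₁' : Matrix (Fin 1) (Fin 1) L} (hJ₁' : J₁' = (-T₁).map (algebraMap (maximalRealSubfield L) L))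
    {J₂ : Matrix (Fin n₂) (Fin n₂) L} (hJ₂ : J₂ = T₂.map (algebraMap (maximalRealSubfield L) L))
    {J : Matrix (Fin (1 + n₂)) (Fin (1 + n₂)) L}
    (hJ : J = (UnitaryGroup.finSum 1 n₂ T₁ T₂).map (algebraMap (maximalRealSubfield L) L))
    (χ : HeckeCharacter L) (hχ : IsSplittingChar L 1 χ) {J' : Matrix (Fin 1) (Fin 1) L} (hJ'0 : J' 0 0 ≠ 0)
    (e' : localPi L (IsCMField.complexConj L) 1 J' v →* ℂˣ) (he'o : IsOpen (e'.ker : Set (localPi L (IsCMField.complexConj L) 1 J' v)))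
    (he' : ∀ z, e' z = ∏ w' : PlacesOver L v, χ.localComponent w'.1 (Matrix.GeneralLinearGroup.det
      (((UnitaryGroup.localCenter L (IsCMField.complexConj L) 1 J₁ J' hJ'0 v z : localPi L (IsCMField.complexConj L) 1 J₁ v) :
        LocalGLPi L 1 v) w'))) :
    Nontrivial (Coinv ((((MpPsi.toRep (localSchrodinger (maximalRealSubfield L) (1 + n₂) (UnitaryGroup.finSum 1 n₂ T₁ T₂) v)).comp
        (localSplittingCMWith L (1 + n₂) (UnitaryGroup.isSymm_finSum hT₁ hT₂) (DoubledBlock.isUnit_det_finSum L 1 n₂ hT₁d hT₂d) hJ χ hχ v μ))).comp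
        (UnitaryGroup.localCenter L (IsCMField.complexConj L) (1 + n₂) J J' hJ'0 v)) e') ↔
      ∃ ζ : localPi L (IsCMField.complexConj L) 1 J' v →* ℂˣ, IsOpen (ζ.ker : Set (localPi L (IsCMField.complexConj L) 1 J' v)) ∧
        Nontrivial (Coinv ((((MpPsi.toRep (localSchrodinger (maximalRealSubfield L) 1 (-T₁) v)).comp
          (localSplittingCMWith L 1 hT₁.neg (isUnit_det_neg_of_isUnit (maximalRealSubfield L) 1 hT₁d) hJ₁' χ hχ v μ))).comp
          ((toNegForm (maximalRealSubfield L) L (IsCMField.complexConj L) v 1 hJ₁ hJ₁').toMonoidHom.comp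
            (UnitaryGroup.localCenter L (IsCMField.complexConj L) 1 J₁ J' hJ'0 v))) ζ) ∧
        Nontrivial (Coinv ((((MpPsi.toRep (localSchrodinger (maximalRealSubfield L) n₂ T₂ v)).comp
          (BlockSum.restrictRight (maximalRealSubfield L) L (IsCMField.complexConj L) v 1 n₂ hJ₂ hJ (complexConj_imagUnit L)
            (imagUnit_ne_zero L) (imagUnit_mul_self L) hT₁ hT₂ hT₁d
            (localSplittingCMWith L (1 + n₂) (UnitaryGroup.isSymm_finSum hT₁ hT₂) (DoubledBlock.isUnit_det_finSum L 1 n₂ hT₁d hT₂d) hJ χ hχ v μ)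
            (proj_localSplittingCMWith L (1 + n₂) (UnitaryGroup.isSymm_finSum hT₁ hT₂) (DoubledBlock.isUnit_det_finSum L 1 n₂ hT₁d hT₂d)
              hJ χ hχ v μ)))).comp
          (UnitaryGroup.localCenter L (IsCMField.complexConj L) n₂ J₂ J' hJ'0 v)) ζ) := by
  have hJ₁0 : J₁ 0 0 ≠ 0 := by
    rw [hJ₁, Matrix.map_apply, map_ne_zero_iff _ (algebraMap (maximalRealSubfield L) L).injective, ← Matrix.det_fin_one T₁]
    exact hT₁d.ne_zero
  haveI hc₁ : CompactSpace (localPi L (IsCMField.complexConj L) 1 J₁ v) :=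
    compactSpace_localPi_rankOne (maximalRealSubfield L) L (IsCMField.complexConj L) (complexConj_imagUnit L) (imagUnit_ne_zero L) hT₁d hJ₁ v hE
  -- the centre isomorphism `eJ : U(J′) ≃* U(J₁)` (both `z ↦ z`), a homeomorphism; so `U(J′)(L⁺_v)` is compact too
  let eJ : localPi L (IsCMField.complexConj L) 1 J' v ≃* localPi L (IsCMField.complexConj L) 1 J₁ v :=
    { toFun := UnitaryGroup.localCenter L (IsCMField.complexConj L) 1 J₁ J' hJ'0 v
      invFun := UnitaryGroup.localCenter L (IsCMField.complexConj L) 1 J' J₁ hJ₁0 v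
      left_inv := fun z => localCenter_one_one_inverse L (IsCMField.complexConj L) J₁ J' hJ₁0 hJ'0 v z
      right_inv := fun z => localCenter_one_one_inverse L (IsCMField.complexConj L) J' J₁ hJ'0 hJ₁0 v z
      map_mul' := map_mul _ }
  have heJ : eJ.toMonoidHom = UnitaryGroup.localCenter L (IsCMField.complexConj L) 1 J₁ J' hJ'0 v := rfl
  have heJc : Continuous eJ := UnitaryGroup.continuous_localCenter L (IsCMField.complexConj L) 1 J₁ J' hJ'0 v
  have heJsc : Continuous eJ.symm := UnitaryGroup.continuous_localCenter L (IsCMField.complexConj L) 1 J' J₁ hJ₁0 v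
  let eH : localPi L (IsCMField.complexConj L) 1 J' v ≃ₜ localPi L (IsCMField.complexConj L) 1 J₁ v :=
    { eJ.toEquiv with continuous_toFun := heJc, continuous_invFun := heJsc }
  haveI : CompactSpace (localPi L (IsCMField.complexConj L) 1 J' v) := eH.symm.compactSpace
  -- smoothness of `ω ∘ s_V` and the line see-saw `restrictLeft s_V = s_{T₁}`
  have hsm := isSmooth_localSplittingCMWith L (1 + n₂) (UnitaryGroup.isSymm_finSum hT₁ hT₂) (DoubledBlock.isUnit_det_finSum L 1 n₂ hT₁d hT₂d)
    hJ χ hχ v μ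
  have hL := DoubledBlock.restrictLeft_localSplittingCMWith L v μ 1 n₂ hT₁ hT₂ hT₁d hT₂d hJ₁ hJ χ hχ Nat.one_pos (fun _ => T₁ 0 0)
    (eq_diagonal_fin_one T₁)
  constructor
  · -- (⇒): a type `ξ` of `s₁ = s_{T₁}` with `e′·(ξ∘c₁)⁻¹` a type of block 2 (criterion); (D) along `φ = c₁` turns `ξ ∘ c₁` into the type
    -- `e′·(ξ∘c₁)⁻¹` of `s_{−T₁} ∘ toNegForm ∘ c₁`
    intro hΘ
    obtain ⟨ξ, hξo, -, -, h₁, h₂⟩ := (nontrivial_theta_iff_exists_lineType (maximalRealSubfield L) L (IsCMField.complexConj L)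
      (complexConj_imagUnit L) (imagUnit_ne_zero L) (imagUnit_mul_self L) v n₂ hT₁ hT₂ hT₁d hT₂d hJ₁ hJ₂ hJ _ _ hJ'0 hE hsm e').1 hΘ
    rw [hL] at h₁
    -- transport `ξ` along `eJ`: `ξ ∘ c₁` is a type of `ω_{T₁} ∘ s_{T₁} ∘ c₁`
    have hker := ker_comp_mulEquiv ((MpPsi.toRep (localSchrodinger (maximalRealSubfield L) 1 T₁ v)).comp
      (localSplittingCMWith L 1 hT₁ hT₁d hJ₁ χ hχ v μ)) ξ eJ
    have h₁' : Nontrivial (Coinv ((((MpPsi.toRep (localSchrodinger (maximalRealSubfield L) 1 T₁ v)).comp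
        (localSplittingCMWith L 1 hT₁ hT₁d hJ₁ χ hχ v μ))).comp (UnitaryGroup.localCenter L (IsCMField.complexConj L) 1 J₁ J' hJ'0 v))
        (ξ.comp (UnitaryGroup.localCenter L (IsCMField.complexConj L) 1 J₁ J' hJ'0 v))) := by
      rw [← heJ]
      exact (Submodule.quotEquivOfEq _ _ hker).toEquiv.nontrivial_congr.2 h₁
    -- (D) for the line `T₁`, `A = U(J′)`, `φ = c₁`, `η = ξ ∘ c₁`, `θ = e′·(ξ ∘ c₁)⁻¹`
    have hD := nontrivial_coinv_localSplittingCMWith_neg_of_nontrivial_coinv_of_det L v μ 1 hJ₁ hJ₁' Nat.one_pos (fun _ => T₁ 0 0)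
      (eq_diagonal_fin_one T₁) hT₁ hT₁d χ hχ (UnitaryGroup.localCenter L (IsCMField.complexConj L) 1 J₁ J' hJ'0 v) heJc
      (ξ.comp (UnitaryGroup.localCenter L (IsCMField.complexConj L) 1 J₁ J' hJ'0 v))
      (e' * (ξ.comp (UnitaryGroup.localCenter L (IsCMField.complexConj L) 1 J₁ J' hJ'0 v))⁻¹)
      (fun a => by rw [MonoidHom.mul_apply, MonoidHom.inv_apply, mul_left_comm, mul_inv_cancel, mul_one, he']) (hξo.preimage heJc) h₁'
    refine ⟨e' * (ξ.comp (UnitaryGroup.localCenter L (IsCMField.complexConj L) 1 J₁ J' hJ'0 v))⁻¹, ?_, hD, h₂⟩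
    -- open kernel: contains `ker e′ ∩ ker (ξ ∘ c₁)`
    refine Subgroup.isOpen_mono (H₁ := e'.ker ⊓ (ξ.comp (UnitaryGroup.localCenter L (IsCMField.complexConj L) 1 J₁ J' hJ'0 v)).ker) ?_
      (he'o.inter (hξo.preimage heJc))
    intro z hz
    rw [Subgroup.mem_inf, MonoidHom.mem_ker, MonoidHom.mem_ker] at hz
    rw [MonoidHom.mem_ker, MonoidHom.mul_apply, MonoidHom.inv_apply, hz.1, hz.2, inv_one, mul_one]
  · -- (⇐): (D) along `φ = c₁` turns `ζ` into the type `e′ ζ⁻¹` of `ω_{T₁} ∘ s_{T₁} ∘ c₁`; transport back along `eJ` to the type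
    -- `ξ = (e′ ζ⁻¹) ∘ c₁⁻¹` of `s_{T₁} = s₁`; then the criterion (⇐) with second character `e′·(ξ∘c₁)⁻¹ = ζ`
    rintro ⟨ζ, hζo, hneg, h₂⟩
    have hD := nontrivial_coinv_localSplittingCMWith_of_nontrivial_coinv_neg_of_det L v μ 1 hJ₁ hJ₁' Nat.one_pos (fun _ => T₁ 0 0)
      (eq_diagonal_fin_one T₁) hT₁ hT₁d χ hχ (UnitaryGroup.localCenter L (IsCMField.complexConj L) 1 J₁ J' hJ'0 v) heJc ζ (e' * ζ⁻¹)
      (fun a => by rw [MonoidHom.mul_apply, MonoidHom.inv_apply, mul_left_comm, mul_inv_cancel, mul_one, he']) hζo hneg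
    -- `ξ := (e′ ζ⁻¹) ∘ eJ⁻¹`, so that `ξ ∘ c₁ = e′ ζ⁻¹`
    have hchar : ((e' * ζ⁻¹).comp eJ.symm.toMonoidHom).comp eJ.toMonoidHom = e' * ζ⁻¹ := by
      refine MonoidHom.ext fun z => ?_
      rw [MonoidHom.comp_apply, MonoidHom.comp_apply, MulEquiv.coe_toMonoidHom, MulEquiv.coe_toMonoidHom, MulEquiv.symm_apply_apply]
    have hker := ker_comp_mulEquiv ((MpPsi.toRep (localSchrodinger (maximalRealSubfield L) 1 T₁ v)).comp
      (localSplittingCMWith L 1 hT₁ hT₁d hJ₁ χ hχ v μ)) ((e' * ζ⁻¹).comp eJ.symm.toMonoidHom) eJ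
    rw [hchar, heJ] at hker
    have h₁ : Nontrivial (Coinv ((MpPsi.toRep (localSchrodinger (maximalRealSubfield L) 1 T₁ v)).comp
        (localSplittingCMWith L 1 hT₁ hT₁d hJ₁ χ hχ v μ)) ((e' * ζ⁻¹).comp eJ.symm.toMonoidHom)) :=
      (Submodule.quotEquivOfEq _ _ hker).toEquiv.nontrivial_congr.1 hD
    rw [← hL] at h₁
    haveI := h₁
    -- the second character of the criterion is `ζ`
    have hchar₂ : e' * (((e' * ζ⁻¹).comp eJ.symm.toMonoidHom).comp
        (UnitaryGroup.localCenter L (IsCMField.complexConj L) 1 J₁ J' hJ'0 v))⁻¹ = ζ := by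
      rw [← heJ, hchar]
      refine MonoidHom.ext fun z => ?_
      rw [MonoidHom.mul_apply, MonoidHom.inv_apply, MonoidHom.mul_apply, MonoidHom.inv_apply, _root_.mul_inv_rev, inv_inv, mul_left_comm,
        mul_inv_cancel, mul_one]
    haveI : Nontrivial (Coinv ((((MpPsi.toRep (localSchrodinger (maximalRealSubfield L) n₂ T₂ v)).comp
          (BlockSum.restrictRight (maximalRealSubfield L) L (IsCMField.complexConj L) v 1 n₂ hJ₂ hJ (complexConj_imagUnit L)
            (imagUnit_ne_zero L) (imagUnit_mul_self L) hT₁ hT₂ hT₁d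
            (localSplittingCMWith L (1 + n₂) (UnitaryGroup.isSymm_finSum hT₁ hT₂) (DoubledBlock.isUnit_det_finSum L 1 n₂ hT₁d hT₂d) hJ χ hχ v μ)
            (proj_localSplittingCMWith L (1 + n₂) (UnitaryGroup.isSymm_finSum hT₁ hT₂) (DoubledBlock.isUnit_det_finSum L 1 n₂ hT₁d hT₂d)
              hJ χ hχ v μ)))).comp
          (UnitaryGroup.localCenter L (IsCMField.complexConj L) n₂ J₂ J' hJ'0 v))
        (e' * (((e' * ζ⁻¹).comp eJ.symm.toMonoidHom).comp
          (UnitaryGroup.localCenter L (IsCMField.complexConj L) 1 J₁ J' hJ'0 v))⁻¹)) := by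
      rw [hchar₂]; exact h₂
    exact nontrivial_theta_of_lineTypes (maximalRealSubfield L) L (IsCMField.complexConj L) (complexConj_imagUnit L) (imagUnit_ne_zero L)
      (imagUnit_mul_self L) v n₂ hT₁ hT₂ hT₁d hT₂d hJ₁ hJ₂ hJ _ _ hJ'0 e' (((e' * ζ⁻¹).comp eJ.symm.toMonoidHom))


set_option synthInstance.maxHeartbeats 400000 in
set_option maxHeartbeats 4000000 in -- block-currency terms
/-- **THE PIN AS DISJOINTNESS.**  In the setting of `nontrivial_theta_localSplittingCMWith_iff_exists_type_neg`, with `e′` moreover unitary and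
continuous, let `χ₀` be «the» vanishing centre character of the CM theta package `ω ∘ s_V ∘ (z ↦ z·1)` — i.e. any character satisfying the dichotomy
«`Θ_{s_V}(χ′) ≠ 0 ⟺ χ′ ≠ χ₀` for all unitary continuous `χ′`» (for the anisotropic plane `T₁ ⊕ a•T₁` at a non-split `v` such a `χ₀` exists, ★
`rankOne_theta_anisotropicPlane_dichotomy_centre`).  Then **`χ₀ = e′` (the pin «the vanishing centre character is `χ_v|_{E_v¹}`») iff NO open-kernel
character of the centre is a type of both `ω_{−T₁} ∘ s_{−T₁} ∘ toNegForm ∘ (z ↦ z)` and the second block `ω_{T₂} ∘ restrictRight(s_V) ∘ (z ↦ z·1)`**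
— the L1ns letter's pin is the DISJOINTNESS of two rank-one type sets (that of the CM section of the negated first line and that of the second block).
[cite: Kudla1994, §3 Thm. 3.1] [cite: HarrisKudlaSweet1996, §6 Thm. 6.1] [cite: MoeglinVignerasWaldspurger1987, Chap. 3 IV.4] [cite: Liu2021, App. D Lemma D.1 (1)] -/
theorem vanishingCentre_eq_iff_forall_not_type_neg (hE : IsField (UnitaryGroup.LocalRing L v))
    (hT₁ : T₁.IsSymm) (hT₂ : T₂.IsSymm) (hT₁d : IsUnit T₁.det) (hT₂d : IsUnit T₂.det)
    {J₁ : Matrix (Fin 1) (Fin 1) L} (hJ₁ : J₁ = T₁.map (algebraMap (maximalRealSubfield L) L))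
    {J₁' : Matrix (Fin 1) (Fin 1) L} (hJ₁' : J₁' = (-T₁).map (algebraMap (maximalRealSubfield L) L))
    {J₂ : Matrix (Fin n₂) (Fin n₂) L} (hJ₂ : J₂ = T₂.map (algebraMap (maximalRealSubfield L) L))
    {J : Matrix (Fin (1 + n₂)) (Fin (1 + n₂)) L}
    (hJ : J = (UnitaryGroup.finSum 1 n₂ T₁ T₂).map (algebraMap (maximalRealSubfield L) L))
    (χ : HeckeCharacter L) (hχ : IsSplittingChar L 1 χ) {J' : Matrix (Fin 1) (Fin 1) L} (hJ'0 : J' 0 0 ≠ 0)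
    (e' : localPi L (IsCMField.complexConj L) 1 J' v →* ℂˣ) (he'o : IsOpen (e'.ker : Set (localPi L (IsCMField.complexConj L) 1 J' v)))
    (he' : ∀ z, e' z = ∏ w' : PlacesOver L v, χ.localComponent w'.1 (Matrix.GeneralLinearGroup.det
      (((UnitaryGroup.localCenter L (IsCMField.complexConj L) 1 J₁ J' hJ'0 v z : localPi L (IsCMField.complexConj L) 1 J₁ v) :
        LocalGLPi L 1 v) w')))
    (he'u : ∀ u, ‖((e' u : ℂˣ) : ℂ)‖ = 1) (he'c : Continuous fun u => ((e' u : ℂˣ) : ℂ))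
    (χ₀ : localPi L (IsCMField.complexConj L) 1 J' v →* ℂˣ)
    (hdich : ∀ χ' : localPi L (IsCMField.complexConj L) 1 J' v →* ℂˣ, (∀ u, ‖((χ' u : ℂˣ) : ℂ)‖ = 1) →
      (Continuous fun u => ((χ' u : ℂˣ) : ℂ)) →
      (Nontrivial (Coinv ((((MpPsi.toRep (localSchrodinger (maximalRealSubfield L) (1 + n₂) (UnitaryGroup.finSum 1 n₂ T₁ T₂) v)).comp
        (localSplittingCMWith L (1 + n₂) (UnitaryGroup.isSymm_finSum hT₁ hT₂) (DoubledBlock.isUnit_det_finSum L 1 n₂ hT₁d hT₂d) hJ χ hχ v μ))).comp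
        (UnitaryGroup.localCenter L (IsCMField.complexConj L) (1 + n₂) J J' hJ'0 v)) χ') ↔ χ' ≠ χ₀)) :
    χ₀ = e' ↔
      ∀ ζ : localPi L (IsCMField.complexConj L) 1 J' v →* ℂˣ, IsOpen (ζ.ker : Set (localPi L (IsCMField.complexConj L) 1 J' v)) →
        Nontrivial (Coinv ((((MpPsi.toRep (localSchrodinger (maximalRealSubfield L) 1 (-T₁) v)).comp
          (localSplittingCMWith L 1 hT₁.neg (isUnit_det_neg_of_isUnit (maximalRealSubfield L) 1 hT₁d) hJ₁' χ hχ v μ))).comp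
          ((toNegForm (maximalRealSubfield L) L (IsCMField.complexConj L) v 1 hJ₁ hJ₁').toMonoidHom.comp
            (UnitaryGroup.localCenter L (IsCMField.complexConj L) 1 J₁ J' hJ'0 v))) ζ) →
        ¬ Nontrivial (Coinv ((((MpPsi.toRep (localSchrodinger (maximalRealSubfield L) n₂ T₂ v)).comp
          (BlockSum.restrictRight (maximalRealSubfield L) L (IsCMField.complexConj L) v 1 n₂ hJ₂ hJ (complexConj_imagUnit L)
            (imagUnit_ne_zero L) (imagUnit_mul_self L) hT₁ hT₂ hT₁d
            (localSplittingCMWith L (1 + n₂) (UnitaryGroup.isSymm_finSum hT₁ hT₂) (DoubledBlock.isUnit_det_finSum L 1 n₂ hT₁d hT₂d) hJ χ hχ v μ)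
            (proj_localSplittingCMWith L (1 + n₂) (UnitaryGroup.isSymm_finSum hT₁ hT₂) (DoubledBlock.isUnit_det_finSum L 1 n₂ hT₁d hT₂d)
              hJ χ hχ v μ)))).comp
          (UnitaryGroup.localCenter L (IsCMField.complexConj L) n₂ J₂ J' hJ'0 v)) ζ) := by
  have key := nontrivial_theta_localSplittingCMWith_iff_exists_type_neg L v μ n₂ hE hT₁ hT₂ hT₁d hT₂d hJ₁ hJ₁' hJ₂ hJ χ hχ hJ'0 e' he'o he'
  have hd := hdich e' he'u he'c
  constructor
  · rintro rfl ζ hζo hneg h2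
    exact (hd.1 (key.2 ⟨ζ, hζo, hneg, h2⟩)) rfl
  · intro h
    by_contra hne
    have hne' : e' ≠ χ₀ := fun h' => hne h'.symm
    obtain ⟨ζ, hζo, hneg, h2⟩ := key.1 (hd.2 hne')
    exact h ζ hζo hneg h2

end Literature.NumberTheory.GelbartRogawski1991.UnitaryDualPair.LocalSplitting

end
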